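import Summits.Ventures.HSemireg.WedgeHankelClassSpaceLoweringCharP
import Summits.Ventures.HSemireg.WedgeHankelClassSpaceRaisingJordanType
import Summits.Ventures.HSemireg.WedgeHankelSubstitutionLowerShearFlag

/-!
# Venture HSemireg — THE JORDAN TYPE OF THE LOWERING OPERATOR: `ker f^k = S(ker e^k) = span{E_j : j < k ∨ (n−j+1)⋯(n−j+k) = 0}`, so `dim ker f^k = dim ker e^k` over every field —
# `min(k, n+1)` when `n!` is a unit, `⌊n/p⌋·min(k,p) + min(k, n mod p + 1)` in characteristic `p` — **all four nilpotents `e`, `f`, `SbC(1 λ 0 1) − 1`, `SbC(1 0 c 1) − 1` of the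
# substitution picture have the SAME JORDAN TYPE on th-7's classes**

HONEST FRAMING. Part of the Lean index of the computation cell `pub-hsemireg` (seat p10 gen 23, Sunday typer «UNIFORM-IN-n»).
Finite-dimensional linear algebra of endomorphisms of th-7's class space ONLY: no variety, no cohomology theory, no sheaf, no Ext group, no semiregularity map;
nothing here says that HC / HC_CM / HC_AV holds; no Literature fact is declared or used.  Custodian versions as in `WedgeHankelSiegelIdeal` (1/3) and `WedgeHankelFrameChange`;
the dictionary (`e`, `f` = the infinitesimal shears, `S` = the Weyl element) is QUOTED, never asserted.

WHAT IS IN THE TREE.  K30 `swap_mul_raising` (`S e = f S`); J-leaf `SbC_swap_mul_swap` (`S² = 1`), `pow_mul_eq_mul_pow_of_mul_eq`, `ker_eq_map_of_conj`, `finrank_ker_eq_of_conj` (conjugate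
endomorphisms have kernels of equal dimension); K-leaf `WedgeHankelSubstitutionLowerShearFlag`: `map_swap_span_spikeBasis` (`S(span{E_i : P i}) = span{E_j : P (rev j)}`),
`finrank_ker_SbC_lower_shear_sub_one_pow_char`; L6 (this seat, `…RaisingJordanType`): `ker_pow_raising_eq_span`, `finrank_ker_pow_raising_of_factorial`, `finrank_ker_pow_raising_charP`,
`finrank_ker_pow_raising_eq_finrank_ker_pow_shear_charP`; L3 (`…LoweringCharP`): `lowering_pow_eq_zero_iff_charP`.
THIS FILE (namespace `Summit.Ventures.HSemireg.Wedge.HankelFrameChange` continued; imports L3, L6 and the lower-shear flag leaf; K27's hypotheses `hE hEtop hF hF0`):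
* §391 **`ker_pow_lowering_eq_map`** (`ker f^k = S(ker e^k)`), **`finrank_ker_pow_lowering_eq`** (`dim ker f^k = dim ker e^k`, every field, `n`, `k`), **`ker_pow_lowering_eq_span`**
  (`ker f^k = span{E_j : j < k ∨ (n−j+1)⋯(n−j+k) = 0 in K}` — spike-spanned, reversed), `finrank_ker_pow_lowering_of_factorial` (`min k (n+1)`).
* §392 characteristic `p`: **`finrank_ker_pow_lowering_charP`** (`⌊n/p⌋·min(k,p) + min(k, n mod p + 1)`), **`finrank_ker_pow_lowering_eq_finrank_ker_pow_lower_shear_charP`** (`= dim ker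
  (SbC(1 0 c 1) − 1)^k`, `c ≠ 0`) and the summary **`jordan_types_agree_charP`**: the four kernel dimensions `dim ker e^k`, `dim ker f^k`, `dim ker (SbC(1 λ 0 1) − 1)^k`,
  `dim ker (SbC(1 0 c 1) − 1)^k` coincide for every `k` (`λ, c ≠ 0`).
NOT typed here: the flags of `e`/`f` versus those of the shears as subspaces (they differ for `p ≤ n`); anything Ext-side.  New names only.
-/

open Module

namespace Summit.Ventures.HSemireg.Wedge.HankelFrameChange

open Summit.Ventures.HSemireg.Wedge Summit.Ventures.HSemireg.Wedge.Kunneth Summit.Ventures.HSemireg.Wedge.Hankel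
  Summit.Ventures.HSemireg.Wedge.BasisFree Summit.Ventures.HSemireg.Wedge.HankelSiegel Summit.Ventures.HSemireg.Wedge.HankelSiegelIdeal
  Summit.Ventures.HSemireg.Wedge.KunnethKernel Summit.Ventures.HSemireg.Wedge.HankelRankOne Summit.Ventures.HSemireg.Wedge.KernelDuality

variable (K : Type*) [Field K] {n : ℕ}

section LoweringType

variable {e f : Module.End K (spikeSpan K n)}
  (hE : ∀ (i : Fin (n + 1)) (hi : (i : ℕ) < n), e (spikeBasis K n i) = (((i : ℕ) : K) + 1) • spikeBasis K n ⟨(i : ℕ) + 1, by omega⟩) (hEtop : e (spikeBasis K n (Fin.last n)) = 0)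
  (hF : ∀ (i : Fin (n + 1)) (hi : 0 < (i : ℕ)), f (spikeBasis K n i) = ((n : K) - (i : ℕ) + 1) • spikeBasis K n ⟨(i : ℕ) - 1, by omega⟩) (hF0 : f (spikeBasis K n 0) = 0)
include hE hEtop hF hF0

/-! ## §391. `ker f^k = S(ker e^k)` -/

/-- `f^k · S = S · e^k`. -/
theorem pow_lowering_mul_swap (k : ℕ) : f ^ k * SbC K 0 1 1 0 = SbC K 0 1 1 0 * e ^ k :=
  pow_mul_eq_mul_pow_of_mul_eq K (swap_mul_raising K hE hEtop hF hF0).symm k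

/-- **`ker f^k = S (ker e^k)`** (every field, every `n`, `k`). -/
theorem ker_pow_lowering_eq_map (k : ℕ) : LinearMap.ker (f ^ k) = (LinearMap.ker (e ^ k)).map (SbC K 0 1 1 0) :=
  ker_eq_map_of_conj K (pow_lowering_mul_swap K hE hEtop hF hF0 k) (SbC_swap_mul_swap K) (SbC_swap_mul_swap K)

/-- **`dim ker f^k = dim ker e^k`** (every field, every `n`, `k`): the lowering and raising operators have the same Jordan type. -/
theorem finrank_ker_pow_lowering_eq (k : ℕ) : finrank K ↥(LinearMap.ker (f ^ k)) = finrank K ↥(LinearMap.ker (e ^ k)) :=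
  finrank_ker_eq_of_conj K (pow_lowering_mul_swap K hE hEtop hF hF0 k) (SbC_swap_mul_swap K) (SbC_swap_mul_swap K)

/-- **`ker f^k = span{E_j : j < k ∨ (n−j+1)⋯(n−j+k) = 0 in K}`** — the reversed spikes of L6's `ker e^k` (every field). -/
theorem ker_pow_lowering_eq_span (k : ℕ) :
    LinearMap.ker (f ^ k) = Submodule.span K (Set.range fun j : {j : Fin (n + 1) // (j : ℕ) < k ∨ (((n - (j : ℕ) + 1).ascFactorial k : ℕ) : K) = 0} => spikeBasis K n j) := by
  rw [ker_pow_lowering_eq_map K hE hEtop hF hF0 k, ker_pow_raising_eq_span K hE hEtop k, map_swap_span_spikeBasis]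
  have hP : ∀ j : Fin (n + 1), (n < ((Fin.rev j : Fin (n + 1)) : ℕ) + k ∨ (((((Fin.rev j : Fin (n + 1)) : ℕ) + 1).ascFactorial k : ℕ) : K) = 0)
      ↔ ((j : ℕ) < k ∨ (((n - (j : ℕ) + 1).ascFactorial k : ℕ) : K) = 0) := by
    intro j
    have hj := j.2
    rw [Fin.val_rev, show n + 1 - ((j : ℕ) + 1) = n - (j : ℕ) by omega]
    constructor
    · rintro (h | h)
      · left; omega
      · exact Or.inr h
    · rintro (h | h)
      · left; omega
      · exact Or.inr h
  apply le_antisymm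
  · rw [Submodule.span_le]
    rintro _ ⟨⟨j, hj⟩, rfl⟩
    exact Submodule.subset_span ⟨⟨j, (hP j).mp hj⟩, rfl⟩
  · rw [Submodule.span_le]
    rintro _ ⟨⟨j, hj⟩, rfl⟩
    exact Submodule.subset_span ⟨⟨j, (hP j).mpr hj⟩, rfl⟩

/-- when `n!` is a unit: **`dim ker f^k = min k (n+1)`** (a single Jordan block). -/
theorem finrank_ker_pow_lowering_of_factorial (hfac : ((n.factorial : ℕ) : K) ≠ 0) (k : ℕ) : finrank K ↥(LinearMap.ker (f ^ k)) = min k (n + 1) := by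
  rw [finrank_ker_pow_lowering_eq K hE hEtop hF hF0 k, finrank_ker_pow_raising_of_factorial K hE hEtop hfac k]

/-! ## §392. Characteristic `p`: all four nilpotents have the same Jordan type -/

/-- **`dim ker f^k = ⌊n/p⌋ · min(k, p) + min(k, n mod p + 1)`** in characteristic `p`. -/
theorem finrank_ker_pow_lowering_charP (p : ℕ) [Fact p.Prime] [CharP K p] (k : ℕ) :
    finrank K ↥(LinearMap.ker (f ^ k)) = n / p * min k p + min k (n % p + 1) := by
  rw [finrank_ker_pow_lowering_eq K hE hEtop hF hF0 k, finrank_ker_pow_raising_charP K hE hEtop p k]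

/-- **`dim ker f^k = dim ker (SbC(1 0 c 1) − 1)^k`** in characteristic `p` (`c ≠ 0`): the lowering operator and the lower shear have the same Jordan type. -/
theorem finrank_ker_pow_lowering_eq_finrank_ker_pow_lower_shear_charP (p : ℕ) [Fact p.Prime] [CharP K p] {c : K} (hc : c ≠ 0) (k : ℕ) :
    finrank K ↥(LinearMap.ker (f ^ k)) = finrank K ↥(LinearMap.ker ((SbC K 1 0 c 1 (n := n) - 1) ^ k)) := by
  rw [finrank_ker_pow_lowering_charP K hE hEtop hF hF0 p k, finrank_ker_SbC_lower_shear_sub_one_pow_char K hc p k]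

/-- **THE FOUR NILPOTENTS OF THE SUBSTITUTION PICTURE HAVE THE SAME JORDAN TYPE in characteristic `p`**: for every `k` and all `λ, c ≠ 0`,
`dim ker e^k = dim ker f^k = dim ker (SbC(1 λ 0 1) − 1)^k = dim ker (SbC(1 0 c 1) − 1)^k` (`= ⌊n/p⌋·min(k,p) + min(k, n mod p + 1)`). -/
theorem jordan_types_agree_charP (p : ℕ) [Fact p.Prime] [CharP K p] {lam c : K} (hlam : lam ≠ 0) (hc : c ≠ 0) (k : ℕ) :
    finrank K ↥(LinearMap.ker (e ^ k)) = finrank K ↥(LinearMap.ker (f ^ k))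
      ∧ finrank K ↥(LinearMap.ker (e ^ k)) = finrank K ↥(LinearMap.ker ((SbC K 1 lam 0 1 (n := n) - 1) ^ k))
      ∧ finrank K ↥(LinearMap.ker (e ^ k)) = finrank K ↥(LinearMap.ker ((SbC K 1 0 c 1 (n := n) - 1) ^ k)) :=
  ⟨(finrank_ker_pow_lowering_eq K hE hEtop hF hF0 k).symm, finrank_ker_pow_raising_eq_finrank_ker_pow_shear_charP K hE hEtop p hlam k,
    by rw [← finrank_ker_pow_lowering_eq K hE hEtop hF hF0 k, finrank_ker_pow_lowering_eq_finrank_ker_pow_lower_shear_charP K hE hEtop hF hF0 p hc k]⟩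

end LoweringType

end Summit.Ventures.HSemireg.Wedge.HankelFrameChange
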